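import Mathlib
import Literature.Analysis.UnboundedOperators.HeatKernelBoundedData
import Literature.Analysis.UnboundedOperators.HeatKernelCommutator

/-!
# Route `FilamentSkeletonRss` · cruxes `TransverseReductionRJ` (stmt-21221, aside) / `TransverseReduction1A` (stmt-27414) —
# line `kelvin_gate`: WEIGHT-ONE HEAT-KERNEL TOOLKIT — `⟨x⟩`-weighted smoothing and the WEIGHTED HÖLDER GRADIENT GAIN

Helper file (theorems only, `--as helper`).  HONEST FRAMING: analysis bookkeeping for a HYPOTHETICAL filament-type rotating
self-similar blow-up route; nothing here bears on Navier–Stokes regularity; no stub is proved here.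

Why (evidence FREE-GATE-PRESSURE-21221-g7 §3): every route to the full free Kelvin gate (project-first, solve-then-project, or
an `R-β` retype of the X/Y scales) needs the heat-kernel gains WITH the polynomial weight of the X-scale, `⟨x⟩ = 1 + |x|`; the
tree has them unweighted (`HeatKernelBoundedData.norm_fderiv_heatExtension_le_of_holder`, BDSV §2.2) and, at weight two for
bounded data, in `…KelvinGateHeatWeight`.  This file is the weight-ONE toolkit in any finite-dimensional inner product space `E`
(`n = dim E`, `c = 2^{n/2}`, `c′ = 1 + 2c`), values in a real Banach space:

* `weight_norm_heatExtension_le` — `(1+|x|)‖e^{tΔ}f(x)‖ ≤ (1 + 2c t^{1/2}) A` if `(1+|y|)‖f‖ ≤ A`;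
* `weight_norm_fderiv_heatExtension_le` — `(1+|x|)‖∇e^{tΔ}f(x)‖ ≤ (2c t^{-1/2} + √2 c c′) A` if `(1+|y|)‖f‖ ≤ A`;
* `weight_norm_fderiv_heatExtension_le_of_local_holder` — **weighted Hölder gradient gain**: if `(1+|z|)‖g(z)‖ ≤ A₀` and
  `g` has the `⟨x⟩`-weighted LOCAL `β`-modulus `(1+|x|)‖g(z) − g(x)‖ ≤ A₁|z − x|^β` for `2|z − x| ≤ 1+|x|`, then
  `(1+|x|)‖∇e^{tΔ}g(x)‖ ≤ c t^{-1/2} c′ (2t)^{β/2} A₁ + 4√2 c c′ A₀`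
  (representation `∇e^{tΔ}g(x) = ∫ ∇G_t(y) ⊗ (g(x−y) − g(x)) dy`; near `y` the weighted modulus, far `y` the bound
  `1+|x| < 2|y|` against the scale-invariant first moment of `|∇G_t|`).
-/

set_option linter.dupNamespace false

noncomputable section

namespace Summit.NavierStokesRegularity.NavierStokesRegularity.Theorems.KelvinGate

open Set Function Filter MeasureTheory Metric Real
open Literature.Analysis.UnboundedOperators
open scoped ENNReal Topology

section WeightOne

variable {E : Type*} [NormedAddCommGroup E] [InnerProductSpace ℝ E] [FiniteDimensional ℝ E]
  [MeasurableSpace E] [BorelSpace E]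
variable {F : Type*} [NormedAddCommGroup F] [NormedSpace ℝ F] [CompleteSpace F]

omit [InnerProductSpace ℝ E] [FiniteDimensional ℝ E] [MeasurableSpace E] [BorelSpace E] [NormedSpace ℝ F]
  [CompleteSpace F] in
/-- The weight moves across a translation: `1 + |x| ≤ (1 + |x − y|) + |y|`, hence
`(1+|x|)‖f(x − y)‖ ≤ A (1 + |y|)` when `(1+|z|)‖f(z)‖ ≤ A`. -/
theorem weight_mul_norm_comp_sub_le {f : E → F} {A : ℝ} (hf : ∀ z, (1 + ‖z‖) * ‖f z‖ ≤ A) (x y : E) :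
    (1 + ‖x‖) * ‖f (x - y)‖ ≤ A * (1 + ‖y‖) := by
  have hA : 0 ≤ A := le_trans (by positivity) (hf 0)
  have h0 : ‖f (x - y)‖ ≤ A := by
    have := hf (x - y); nlinarith [norm_nonneg (f (x - y)), norm_nonneg (x - y)]
  have h1 : ‖x‖ ≤ ‖x - y‖ + ‖y‖ := by
    calc ‖x‖ = ‖(x - y) + y‖ := by rw [sub_add_cancel]
      _ ≤ ‖x - y‖ + ‖y‖ := norm_add_le _ _
  calc (1 + ‖x‖) * ‖f (x - y)‖ ≤ ((1 + ‖x - y‖) + ‖y‖) * ‖f (x - y)‖ :=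
        mul_le_mul_of_nonneg_right (by linarith) (norm_nonneg _)
    _ = (1 + ‖x - y‖) * ‖f (x - y)‖ + ‖y‖ * ‖f (x - y)‖ := by ring
    _ ≤ A + ‖y‖ * A := add_le_add (hf _) (mul_le_mul_of_nonneg_left h0 (norm_nonneg _))
    _ = A * (1 + ‖y‖) := by ring

omit [CompleteSpace F] in
/-- **Weight-one smoothing**: `(1+|x|)‖e^{tΔ}f(x)‖ ≤ (1 + 2·2^{n/2} t^{1/2}) A` for `f` with `(1+|y|)‖f‖ ≤ A`
(no measurability needed: the bound is pointwise under the Bochner integral). -/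
theorem weight_norm_heatExtension_le {f : E → F} {A : ℝ} (hf : ∀ z, (1 + ‖z‖) * ‖f z‖ ≤ A)
    {t : ℝ} (ht : 0 < t) (x : E) :
    (1 + ‖x‖) * ‖heatExtension f t x‖ ≤
      (1 + 2 * (2 : ℝ) ^ ((Module.finrank ℝ E : ℝ) / 2) * t ^ (1 / 2 : ℝ)) * A := by
  have hA : 0 ≤ A := le_trans (by positivity) (hf 0)
  have h0 : ∀ z, ‖f z‖ ≤ A := fun z => by
    have := hf z; nlinarith [norm_nonneg (f z), norm_nonneg z]
  have hK := integrable_heatKernel_holds (E := E) ht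
  have hM := integrable_heatKernel_mul_norm (E := E) ht
  have hx : 0 < 1 + ‖x‖ := by linarith [norm_nonneg x]
  rw [heatExtension_apply]
  have hb : ∀ y, ‖heatKernel t y • f (x - y)‖ ≤ (1 + ‖x‖)⁻¹ * (A * (heatKernel t y * (1 + ‖y‖))) := by
    intro y
    rw [norm_smul, Real.norm_of_nonneg (heatKernel_pos ht y).le, le_inv_mul_iff₀ hx]
    calc (1 + ‖x‖) * (heatKernel t y * ‖f (x - y)‖) = heatKernel t y * ((1 + ‖x‖) * ‖f (x - y)‖) := by ring
      _ ≤ heatKernel t y * (A * (1 + ‖y‖)) :=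
          mul_le_mul_of_nonneg_left (weight_mul_norm_comp_sub_le hf x y) (heatKernel_pos ht y).le
      _ = A * (heatKernel t y * (1 + ‖y‖)) := by ring
  have hI : Integrable (fun y : E => (1 + ‖x‖)⁻¹ * (A * (heatKernel t y * (1 + ‖y‖)))) := by
    have : Integrable (fun y : E => heatKernel t y * (1 + ‖y‖)) := by
      have e : (fun y : E => heatKernel t y * (1 + ‖y‖)) = fun y => heatKernel t y + heatKernel t y * ‖y‖ := by
        funext y; ring
      rw [e]; exact hK.add hM
    exact (this.const_mul A).const_mul _
  calc (1 + ‖x‖) * ‖∫ y, heatKernel t y • f (x - y)‖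
      ≤ (1 + ‖x‖) * ∫ y, (1 + ‖x‖)⁻¹ * (A * (heatKernel t y * (1 + ‖y‖))) :=
        mul_le_mul_of_nonneg_left (norm_integral_le_of_norm_le hI (Eventually.of_forall hb)) hx.le
    _ = A * (∫ y : E, heatKernel t y + heatKernel t y * ‖y‖) := by
        rw [integral_const_mul, integral_const_mul, ← mul_assoc, mul_inv_cancel₀ hx.ne', one_mul]
        congr 1
        exact integral_congr_ae (Eventually.of_forall fun y => by ring)
    _ = A * (1 + ∫ y : E, heatKernel t y * ‖y‖) := by
        rw [integral_add hK hM, integral_heatKernel_eq_one_holds ht]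
    _ ≤ A * (1 + 2 * (2 : ℝ) ^ ((Module.finrank ℝ E : ℝ) / 2) * t ^ (1 / 2 : ℝ)) := by
        have := integral_heatKernel_mul_norm_le (E := E) ht
        nlinarith
    _ = _ := by ring

/-- **Weight-one gradient bound for bounded weighted data**:
`(1+|x|)‖∇e^{tΔ}f(x)‖ ≤ (2·2^{n/2} t^{-1/2} + √2·2^{n/2}(1 + 2·2^{n/2})) A` for continuous `f` with `(1+|y|)‖f‖ ≤ A`
(representation `∇e^{tΔ}f(x) = ∫ ∇G_t(y) ⊗ (f(x−y) − f(x)) dy` and `(1+|x|)(‖f(x−y)‖ + ‖f(x)‖) ≤ A(2 + |y|)`). -/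
theorem weight_norm_fderiv_heatExtension_le {f : E → F} (hfc : Continuous f) {A : ℝ} (hf : ∀ z, (1 + ‖z‖) * ‖f z‖ ≤ A)
    {t : ℝ} (ht : 0 < t) (x : E) :
    (1 + ‖x‖) * ‖fderiv ℝ (heatExtension f t) x‖ ≤
      (2 * (2 : ℝ) ^ ((Module.finrank ℝ E : ℝ) / 2) * t ^ (-(1 / 2 : ℝ)) +
        (2 : ℝ) ^ (1 / 2 : ℝ) * (2 : ℝ) ^ ((Module.finrank ℝ E : ℝ) / 2) *
          (1 + 2 * (2 : ℝ) ^ ((Module.finrank ℝ E : ℝ) / 2))) * A := by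
  have hA : 0 ≤ A := le_trans (by positivity) (hf 0)
  have h0 : ∀ z, ‖f z‖ ≤ A := fun z => by
    have := hf z; nlinarith [norm_nonneg (f z), norm_nonneg z]
  have hx : 0 < 1 + ‖x‖ := by linarith [norm_nonneg x]
  obtain ⟨hM1, hM1le⟩ := integral_norm_fderiv_heatKernel_mul_norm_le (E := E) ht
  have hK1 := integrable_norm_fderiv_heatKernel (E := E) ht
  rw [fderiv_heatExtension_eq_integral_sub_self hfc h0 ht x]
  -- pointwise: `(1+|x|)‖∇G(y) ⊗ (f(x-y) - f(x))‖ ≤ A ‖∇G(y)‖ (2+|y|)`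
  have hb : ∀ y, ‖(fderiv ℝ (heatKernel t) y).smulRight (f (x - y) - f x)‖ ≤
      (1 + ‖x‖)⁻¹ * (A * (‖fderiv ℝ (heatKernel t) y‖ * (2 + ‖y‖))) := by
    intro y
    rw [ContinuousLinearMap.norm_smulRight_apply, le_inv_mul_iff₀ hx]
    have h2 : (1 + ‖x‖) * ‖f (x - y) - f x‖ ≤ A * (2 + ‖y‖) := by
      calc (1 + ‖x‖) * ‖f (x - y) - f x‖ ≤ (1 + ‖x‖) * (‖f (x - y)‖ + ‖f x‖) :=
            mul_le_mul_of_nonneg_left (norm_sub_le _ _) hx.le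
        _ = (1 + ‖x‖) * ‖f (x - y)‖ + (1 + ‖x‖) * ‖f x‖ := by ring
        _ ≤ A * (1 + ‖y‖) + A := add_le_add (weight_mul_norm_comp_sub_le hf x y) (hf x)
        _ = A * (2 + ‖y‖) := by ring
    calc (1 + ‖x‖) * (‖fderiv ℝ (heatKernel t) y‖ * ‖f (x - y) - f x‖)
        = ‖fderiv ℝ (heatKernel t) y‖ * ((1 + ‖x‖) * ‖f (x - y) - f x‖) := by ring
      _ ≤ ‖fderiv ℝ (heatKernel t) y‖ * (A * (2 + ‖y‖)) := mul_le_mul_of_nonneg_left h2 (norm_nonneg _)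
      _ = A * (‖fderiv ℝ (heatKernel t) y‖ * (2 + ‖y‖)) := by ring
  have hsum : Integrable (fun y : E => ‖fderiv ℝ (heatKernel t) y‖ * (2 + ‖y‖)) := by
    have e : (fun y : E => ‖fderiv ℝ (heatKernel t) y‖ * (2 + ‖y‖)) =
        fun y => 2 * ‖fderiv ℝ (heatKernel t) y‖ + ‖fderiv ℝ (heatKernel t) y‖ * ‖y‖ := by
      funext y; ring
    rw [e]; exact (hK1.const_mul 2).add hM1
  have hI : Integrable (fun y : E => (1 + ‖x‖)⁻¹ * (A * (‖fderiv ℝ (heatKernel t) y‖ * (2 + ‖y‖)))) :=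
    (hsum.const_mul A).const_mul _
  calc (1 + ‖x‖) * ‖∫ y, (fderiv ℝ (heatKernel t) y).smulRight (f (x - y) - f x)‖
      ≤ (1 + ‖x‖) * ∫ y, (1 + ‖x‖)⁻¹ * (A * (‖fderiv ℝ (heatKernel t) y‖ * (2 + ‖y‖))) :=
        mul_le_mul_of_nonneg_left (norm_integral_le_of_norm_le hI (Eventually.of_forall hb)) hx.le
    _ = A * (∫ y : E, 2 * ‖fderiv ℝ (heatKernel t) y‖ + ‖fderiv ℝ (heatKernel t) y‖ * ‖y‖) := by
        rw [integral_const_mul, integral_const_mul, ← mul_assoc, mul_inv_cancel₀ hx.ne', one_mul]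
        congr 1
        exact integral_congr_ae (Eventually.of_forall fun y => by ring)
    _ = A * (2 * (∫ y : E, ‖fderiv ℝ (heatKernel t) y‖) + ∫ y : E, ‖fderiv ℝ (heatKernel t) y‖ * ‖y‖) := by
        rw [integral_add (hK1.const_mul 2) hM1, integral_const_mul]
    _ ≤ A * (2 * ((2 : ℝ) ^ ((Module.finrank ℝ E : ℝ) / 2) * t ^ (-(1 / 2 : ℝ))) +
          (2 : ℝ) ^ (1 / 2 : ℝ) * (2 : ℝ) ^ ((Module.finrank ℝ E : ℝ) / 2) *
            (1 + 2 * (2 : ℝ) ^ ((Module.finrank ℝ E : ℝ) / 2))) := by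
        refine mul_le_mul_of_nonneg_left (add_le_add ?_ hM1le) hA
        exact mul_le_mul_of_nonneg_left (integral_norm_fderiv_heatKernel_le ht) zero_le_two
    _ = _ := by ring

/-- **WEIGHTED HÖLDER GRADIENT GAIN.**  Let `g` be continuous with `(1+|z|)‖g(z)‖ ≤ A₀` and with the `⟨x⟩`-weighted local
`β`-modulus `(1+|x|)‖g(z) − g(x)‖ ≤ A₁|z − x|^β` whenever `2|z − x| ≤ 1+|x|` (`0 ≤ β ≤ 1`).  Then for `t > 0`
`(1+|x|)‖∇e^{tΔ}g(x)‖ ≤ 2^{n/2} t^{-1/2} (1+2·2^{n/2}) (2t)^{β/2} A₁ + 4·√2·2^{n/2}(1+2·2^{n/2}) A₀`. -/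
theorem weight_norm_fderiv_heatExtension_le_of_local_holder {g : E → F} (hgc : Continuous g) {A₀ A₁ β : ℝ}
    (hA₁ : 0 ≤ A₁) (hβ0 : 0 ≤ β) (hβ1 : β ≤ 1) (h0 : ∀ z, (1 + ‖z‖) * ‖g z‖ ≤ A₀)
    (h1 : ∀ x z, 2 * ‖z - x‖ ≤ 1 + ‖x‖ → (1 + ‖x‖) * ‖g z - g x‖ ≤ A₁ * ‖z - x‖ ^ β)
    {t : ℝ} (ht : 0 < t) (x : E) :
    (1 + ‖x‖) * ‖fderiv ℝ (heatExtension g t) x‖ ≤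
      (2 : ℝ) ^ ((Module.finrank ℝ E : ℝ) / 2) * t ^ (-(1 / 2 : ℝ)) *
          ((1 + 2 * (2 : ℝ) ^ ((Module.finrank ℝ E : ℝ) / 2)) * (2 * t) ^ (β / 2)) * A₁ +
        4 * ((2 : ℝ) ^ (1 / 2 : ℝ) * (2 : ℝ) ^ ((Module.finrank ℝ E : ℝ) / 2) *
          (1 + 2 * (2 : ℝ) ^ ((Module.finrank ℝ E : ℝ) / 2))) * A₀ := by
  have hA₀ : 0 ≤ A₀ := le_trans (by positivity) (h0 0)
  have hC : ∀ z, ‖g z‖ ≤ A₀ := fun z => by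
    have := h0 z; nlinarith [norm_nonneg (g z), norm_nonneg z]
  have hx : 0 < 1 + ‖x‖ := by linarith [norm_nonneg x]
  rw [fderiv_heatExtension_eq_integral_sub_self hgc hC ht x]
  obtain ⟨hM1, hM1le⟩ := integral_norm_fderiv_heatKernel_mul_norm_le (E := E) ht
  have hK1 := integrable_norm_fderiv_heatKernel (E := E) ht
  -- the majorant `b(y) = ‖∇G(y)‖ (A₁ |y|^β + 4 A₀ |y|)`
  have hβint : Integrable (fun y : E => ‖fderiv ℝ (heatKernel t) y‖ * ‖y‖ ^ β) := by
    refine (hK1.add hM1).mono' (((continuous_fderiv_heatKernel t).norm.mul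
      (continuous_norm.rpow_const fun _ => Or.inr hβ0)).aestronglyMeasurable) (Eventually.of_forall fun y => ?_)
    rw [Real.norm_of_nonneg (mul_nonneg (norm_nonneg _) (rpow_nonneg (norm_nonneg _) _))]
    have hsplit := rpow_le_rpow_add_rpow_sub_one_mul (norm_nonneg y) one_pos hβ0 hβ1
    simp only [Real.one_rpow, one_mul] at hsplit
    calc ‖fderiv ℝ (heatKernel t) y‖ * ‖y‖ ^ β ≤ ‖fderiv ℝ (heatKernel t) y‖ * (1 + ‖y‖) :=
          mul_le_mul_of_nonneg_left hsplit (norm_nonneg _)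
      _ = ‖fderiv ℝ (heatKernel t) y‖ + ‖fderiv ℝ (heatKernel t) y‖ * ‖y‖ := by ring
  have hbI : Integrable (fun y : E => (1 + ‖x‖)⁻¹ *
      (A₁ * (‖fderiv ℝ (heatKernel t) y‖ * ‖y‖ ^ β) + 4 * A₀ * (‖fderiv ℝ (heatKernel t) y‖ * ‖y‖))) :=
    ((hβint.const_mul A₁).add (hM1.const_mul (4 * A₀))).const_mul _
  have hb : ∀ y, ‖(fderiv ℝ (heatKernel t) y).smulRight (g (x - y) - g x)‖ ≤ (1 + ‖x‖)⁻¹ *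
      (A₁ * (‖fderiv ℝ (heatKernel t) y‖ * ‖y‖ ^ β) + 4 * A₀ * (‖fderiv ℝ (heatKernel t) y‖ * ‖y‖)) := by
    intro y
    rw [ContinuousLinearMap.norm_smulRight_apply, le_inv_mul_iff₀ hx]
    have key : (1 + ‖x‖) * ‖g (x - y) - g x‖ ≤ A₁ * ‖y‖ ^ β + 4 * A₀ * ‖y‖ := by
      by_cases hy : 2 * ‖y‖ ≤ 1 + ‖x‖
      · have h := h1 x (x - y) (by rwa [show x - y - x = -y by abel, norm_neg])
        rw [show x - y - x = -y by abel, norm_neg] at h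
        have : 0 ≤ 4 * A₀ * ‖y‖ := by positivity
        linarith
      · rw [not_le] at hy
        have h2 : ‖g (x - y) - g x‖ ≤ A₀ + A₀ := (norm_sub_le _ _).trans (add_le_add (hC _) (hC _))
        have : 0 ≤ A₁ * ‖y‖ ^ β := by positivity
        calc (1 + ‖x‖) * ‖g (x - y) - g x‖ ≤ (2 * ‖y‖) * (A₀ + A₀) :=
              mul_le_mul hy.le h2 (norm_nonneg _) (by positivity)
          _ = 4 * A₀ * ‖y‖ := by ring
          _ ≤ A₁ * ‖y‖ ^ β + 4 * A₀ * ‖y‖ := by linarith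
    calc (1 + ‖x‖) * (‖fderiv ℝ (heatKernel t) y‖ * ‖g (x - y) - g x‖)
        = ‖fderiv ℝ (heatKernel t) y‖ * ((1 + ‖x‖) * ‖g (x - y) - g x‖) := by ring
      _ ≤ ‖fderiv ℝ (heatKernel t) y‖ * (A₁ * ‖y‖ ^ β + 4 * A₀ * ‖y‖) :=
          mul_le_mul_of_nonneg_left key (norm_nonneg _)
      _ = _ := by ring
  calc (1 + ‖x‖) * ‖∫ y, (fderiv ℝ (heatKernel t) y).smulRight (g (x - y) - g x)‖
      ≤ (1 + ‖x‖) * ∫ y, (1 + ‖x‖)⁻¹ *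
          (A₁ * (‖fderiv ℝ (heatKernel t) y‖ * ‖y‖ ^ β) + 4 * A₀ * (‖fderiv ℝ (heatKernel t) y‖ * ‖y‖)) :=
        mul_le_mul_of_nonneg_left (norm_integral_le_of_norm_le hbI (Eventually.of_forall hb)) hx.le
    _ = A₁ * (∫ y : E, ‖fderiv ℝ (heatKernel t) y‖ * ‖y‖ ^ β) +
          4 * A₀ * ∫ y : E, ‖fderiv ℝ (heatKernel t) y‖ * ‖y‖ := by
        rw [integral_const_mul, ← mul_assoc, mul_inv_cancel₀ hx.ne', one_mul,
          integral_add (hβint.const_mul A₁) (hM1.const_mul (4 * A₀)), integral_const_mul, integral_const_mul]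
    _ ≤ A₁ * ((2 : ℝ) ^ ((Module.finrank ℝ E : ℝ) / 2) * t ^ (-(1 / 2 : ℝ)) *
          ((1 + 2 * (2 : ℝ) ^ ((Module.finrank ℝ E : ℝ) / 2)) * (2 * t) ^ (β / 2))) +
          4 * A₀ * ((2 : ℝ) ^ (1 / 2 : ℝ) * (2 : ℝ) ^ ((Module.finrank ℝ E : ℝ) / 2) *
            (1 + 2 * (2 : ℝ) ^ ((Module.finrank ℝ E : ℝ) / 2))) :=
        add_le_add (mul_le_mul_of_nonneg_left (integral_norm_fderiv_heatKernel_mul_norm_rpow_le ht hβ0 hβ1) hA₁)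
          (mul_le_mul_of_nonneg_left hM1le (by positivity))
    _ = _ := by ring

end WeightOne

end Summit.NavierStokesRegularity.NavierStokesRegularity.Theorems.KelvinGate

end
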